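import Literature.Geometry.Kaehler.ComplexTorusHodgeStructureHomomorphisms
import Literature.Geometry.Kaehler.ComplexTorusEndomorphismFieldEigenspaces
import Literature.AlgebraicGeometry.Motives.WeilTypeCMProofs
import Mathlib.LinearAlgebra.Dual.Lemmas
import HarnessLib

/-!
# The multiplicity dictionary `H¹(X, ℚ) ↔ T₀X`: for `B ∈ End_ℚ(X)` the `μ`-eigenspace of `(B^*)_ℂ` in `H^{1,0}(X)` has the
# dimension of the `μ`-eigenspace of `ρ_a(B)` on the tangent space, and in `H^{0,1}(X)` that of the `μ̄`-eigenspace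
# (Lange 2023, Thm. 1.1.21 (b) `H^{1,0}(X) ≅ Ω = Hom_ℂ(V, ℂ)`; Moonen–Zarhin 1998 §3 (3), Zarhin 2004 §2: the multiplicities `n_σ`)

Layer `Literature/Geometry/Kaehler`, namespace `Literature.Geometry.Kaehler.ComplexTorus`; lane `lit-hodgefound` (Track 2
foundations library), prover seat `lit-hodgefound-p17` (generation 58), self-proposed row g58-#4 — the piece of the carrier
bridge `H₁ ↔ H¹` (g58-#1 `ComplexTorusFirstCohomologyHodgeLieAlgebraBridge`, g58-#3 `…LefschetzLieAlgebraBridge`) that reads the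
TANGENT multiplicities of an endomorphism (the tree's `n_σ = dim_ℂ {v ∈ T₀X | ρ_a(f y) v = σ(y) v ∀ y}`,
`ComplexTorusEndomorphismFieldEigenspaces`) on the RATIONAL HODGE STRUCTURE `hodgeStructure Φ 1` of `H¹(X, ℚ)`, where the tree's
abstract Lie theorems (`Motives/HodgeThetaSubalgebraUnitary…`: hypotheses `dim (ker(φ_ℂ − μ) ∩ V^{1,0})`, `dim (ker(φ_ℂ − μ) ∩ V^{0,1})`)
are stated.  THEOREMS ONLY (no definition, no instance, no notation, no named fact; D-0026, net debt 0).  The twin, on the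
HOMOLOGY side `H₁(X, ℂ) = ℂ^ι ⊃ V^{-1,0} ≅ T₀X`, is p11's `finrank_iInf_eigenspace_analyticRepHom_eq_finrank_inf`
(`ComplexTorusEndomorphismSubfieldMultiplicitiesCenter`); the twin on the Betti side of `AbelianVariety ℂ` is R9's
`finrank_eigenspace_inf_piece_oneZero_eq_eigenMultiplicity` ∕ `…_zeroOne_eq_eigenMultiplicity_conj`.

## Sources, VERBATIM (held copies; `p0NNN Lnn` = chunk file and line of the materialised text)

* H. Lange [Lange2023AbelianVarietiesComplex], *Abelian Varieties over the Complex Numbers* (2023), §1.1.5 Thm. 1.1.21 (b):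
  «`H^{1,0}(X) ≅ Ω = Hom_ℂ(V, ℂ)` and `H^{0,1}(X) ≅ Ω̄ = Hom_{ℂ̄}(V, ℂ)`» (the holomorphic one-forms are the `ℂ`-linear forms on
  `V = T₀X`, the antiholomorphic ones the `ℂ`-antilinear forms); §1.1.2 Prop. 1.1.6, Prop. 1.1.9 («`ρ_r ⊗ 1 ≅ ρ_a ⊕ ρ̄_a`»).
* B. Moonen, Yu. G. Zarhin [MoonenZarhin1998WeilClasses], *Weil classes on abelian varieties*, J. reine angew. Math. 496 (1998),
  §3 (3): «The dimension `n_σ` of `V^{1,0}_{ℂ,σ}` is called the multiplicity of `σ`», with `n_σ + n_σ̄ = dim_k V`.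
* Yu. G. Zarhin [Zarhin2004EndomorphismRingsCyclicCovers], Math. Proc. Cambridge Philos. Soc. 136 (2004), §2 (held
  `paper:arxiv-math_0103203`, p0004): «the `End⁰(Z)`-module `H^{-1,0}` is canonically isomorphic to `Lie(Z)`. […]
  `n_σ = dim_ℂ Lie(Z)_σ`».
* C. Voisin [VoisinHodgeI2002], *Hodge Theory and Complex Algebraic Geometry I*, §7.2.2 (PDF p. 142: «`H^{1,0}(T) = V^*`»),
  §7.3.2 (PDF p. 149–150: `φ^*` on cohomology is the pull-back of forms, a morphism of Hodge structures).

## What is proved (`X = E/Φ(ℤ^ι)` a complex torus, `B ∈ End_ℚ(X) = endAlgRat Φ`, `ρ_a(B) = analyticRepHom Φ B : E →L[ℂ] E`,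
## `B^* = pullbackFormsRat Φ Φ B 1 : H¹(X, ℚ) → H¹(X, ℚ)`, `μ ∈ ℂ`)

* §0 (file-local linear algebra) `finrank_eigenspace_dualMap_eq`: `dim ker(ᵗf − μ) = dim ker(f − μ)` on the dual space.
* §1 **`finrank_eigenspace_baseChange_pullbackFormsRat_inf_piece_one_zero_eq`**:
  `dim_ℂ (ker((B^*)_ℂ − μ) ∩ H^{1,0}(X)) = dim_ℂ ker(ρ_a(B) − μ)` — the `(1,0)`-classes are the `ℂ`-linear forms `ℓ` on `E`
  (`isOfTypeAt_one_zero_iff`), `(B^*)_ℂ ℓ = ℓ ∘ ρ_a(B)` (`complexification_baseChange_pullbackFormsRat`), so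
  `ker((B^*)_ℂ − μ) ∩ H^{1,0} ≅ ker(ᵗρ_a(B) − μ) ⊆ Hom_ℂ(E, ℂ)`, of the dimension of `ker(ρ_a(B) − μ)` (§0);
  **`finrank_eigenspace_baseChange_pullbackFormsRat_inf_piece_zero_one_eq`**:
  `dim_ℂ (ker((B^*)_ℂ − μ) ∩ H^{0,1}(X)) = dim_ℂ ker(ρ_a(B) − μ̄)` (complex conjugation: `conj H^{0,1} = H^{1,0}`, `B^*` is
  defined over `ℚ`).
* §2 for a number field `f : K → End_ℚ(X)` with a generator `θ` (`ℚ(θ) = K`) and `σ : K → ℂ`: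
  **`finrank_eigenspace_baseChange_pullbackFormsRat_inf_piece_one_zero_eq_finrank_iInf_eigenspace`** (`= n_σ`, the tangent
  multiplicity of `σ`) and **`…_piece_zero_one_eq_finrank_iInf_eigenspace_conjugate`** (`= n_σ̄`).
-/

noncomputable section

open scoped TensorProduct ComplexConjugate
open Module Complex
open Literature.Analysis.Complex
open Literature.AlgebraicGeometry.Motives.HodgeStructure (complexConj complexConj_inf complexConj_piece finrank_complexConj)
open Literature.AlgebraicGeometry.Motives.HodgeStructure.EndAction (complexConj_eigenspace_baseChange)

namespace Literature.Geometry.Kaehler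

namespace ComplexTorus

/-! ## §0 Linear algebra: the eigenspaces of the transpose have the same dimensions -/

/-- `dim ker(ᵗf − μ) = dim ker(f − μ)` for an endomorphism `f` of a finite-dimensional vector space and its transpose `ᵗf`
on the dual space (`rk ᵗg = rk g` for `g = f − μ`); file-local linear algebra. [folklore] -/
private theorem finrank_eigenspace_dualMap_eq {K V : Type*} [Field K] [AddCommGroup V] [Module K V] [FiniteDimensional K V]
    (f : Module.End K V) (μ : K) :
    finrank K ↥(Module.End.eigenspace f.dualMap μ) = finrank K ↥(Module.End.eigenspace f μ) := by
  set g : Module.End K V := f - μ • LinearMap.id with hg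
  have h1 : Module.End.eigenspace f μ = LinearMap.ker g := by
    ext v
    rw [Module.End.mem_eigenspace_iff, LinearMap.mem_ker, hg, LinearMap.sub_apply, LinearMap.smul_apply,
      LinearMap.id_apply, sub_eq_zero]
  have h2 : Module.End.eigenspace f.dualMap μ = LinearMap.ker g.dualMap := by
    ext ℓ
    rw [Module.End.mem_eigenspace_iff, LinearMap.mem_ker, LinearMap.ext_iff, LinearMap.ext_iff]
    refine forall_congr' fun v ↦ ?_
    simp only [LinearMap.dualMap_apply, LinearMap.zero_apply, hg, LinearMap.sub_apply, LinearMap.smul_apply,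
      LinearMap.id_coe, id_eq, map_sub, map_smul, smul_eq_mul]
    rw [sub_eq_zero]
  rw [h1, h2]
  have h3 := LinearMap.finrank_range_add_finrank_ker g.dualMap
  have h4 := LinearMap.finrank_range_add_finrank_ker g
  rw [LinearMap.finrank_range_dualMap_eq_finrank_range, Subspace.dual_finrank_eq] at h3
  omega

/-! ## §1 One endomorphism `B ∈ End_ℚ(X)`: `H^{1,0}` sees `ker(ρ_a(B) − μ)`, `H^{0,1}` sees `ker(ρ_a(B) − μ̄)` -/

section One

variable {ι : Type*} [Fintype ι] [DecidableEq ι] {E : Type*} [NormedAddCommGroup E] [NormedSpace ℂ E]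
  (Φ : (ι → ℝ) ≃L[ℝ] E)

/-- The functional `v ↦ Θ(x)(v)` of a class `x ∈ H¹(X, ℂ)` (`Θ` the comparison `ℂ ⊗ H¹(X, ℚ) ≅ Alt¹_ℝ(E; ℂ)`), and its
behaviour under `(B^*)_ℂ`: `Θ((B^*)_ℂ x)(v) = Θ(x)(ρ_a(B) v)` («`φ^*` is the pull-back of forms»).
[cite: VoisinHodgeI2002, §7.3.2 (PDF p. 149)] [cite: Lange2023AbelianVarietiesComplex, §1.1.2 Prop. 1.1.6] -/
theorem oneForm_symm_complexification_baseChange_pullbackFormsRat {B : Matrix ι ι ℚ} (hB : B ∈ endAlgRat Φ)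
    (x : ℂ ⊗[ℚ] rationalForms Φ 1) (v : E) :
    oneForm.symm (complexification Φ 1 ((pullbackFormsRat Φ Φ B 1).baseChange ℂ x)) v =
      oneForm.symm (complexification Φ 1 x) (analyticRepHom Φ ⟨B, hB⟩ v) := by
  rw [oneForm_symm_apply, oneForm_symm_apply, complexification_baseChange_pullbackFormsRat, pullbackAlt_apply,
    ContinuousAlternatingMap.compContinuousLinearMap_apply]
  congr 1

omit [DecidableEq ι] in
/-- A class `x ∈ H¹(X, ℂ)` lies in `H^{1,0}(X)` iff its functional `v ↦ Θ(x)(v)` is `ℂ`-linear («`H^{1,0}(X) ≅ Ω = Hom_ℂ(V, ℂ)`»).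
[cite: Lange2023AbelianVarietiesComplex, §1.1.5 Thm. 1.1.21 (b)] [cite: VoisinHodgeI2002, §7.2.2 (PDF p. 142)] -/
theorem mem_piece_one_zero_iff_forall_smul (x : ℂ ⊗[ℚ] rationalForms Φ 1) :
    x ∈ (hodgeStructure Φ 1).piece 1 0 ↔
      ∀ (c : ℂ) (v : E), oneForm.symm (complexification Φ 1 x) (c • v) = c * oneForm.symm (complexification Φ 1 x) v := by
  have h := mem_piece_hodgeStructure_iff Φ 1 (p := 1) (q := 0) rfl (x := x)
  simp only [Nat.cast_one, Nat.cast_zero] at h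
  rw [h, mem_typeSubmodule_iff_isOfTypeAt (show (1 : ℕ) + 0 = 1 from rfl), ← isOfTypeAt_one_zero_iff,
    LinearEquiv.apply_symm_apply]

/-- **THE `(1,0)` MULTIPLICITY OF `B^*` IS THE TANGENT MULTIPLICITY: `dim_ℂ (ker((B^*)_ℂ − μ) ∩ H^{1,0}(X)) = dim_ℂ ker(ρ_a(B) − μ)`**
for `B ∈ End_ℚ(X)` and `μ ∈ ℂ`.  The `(1,0)`-classes of `H¹(X, ℂ)` are the `ℂ`-linear forms `ℓ` on `E = T₀X`, on which `(B^*)_ℂ`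
acts by `ℓ ↦ ℓ ∘ ρ_a(B)` — the transpose of `ρ_a(B)` —, so `ker((B^*)_ℂ − μ) ∩ H^{1,0}(X) ≅ ker(ᵗρ_a(B) − μ)`, of the dimension
of `ker(ρ_a(B) − μ)`.  («`H^{1,0}(X) ≅ Ω = Hom_ℂ(V, ℂ)`»; the multiplicity `n_σ` «of `V^{1,0}_{ℂ,σ}`» equals the multiplicity on
`Lie(Z)`.) [cite: Lange2023AbelianVarietiesComplex, §1.1.5 Thm. 1.1.21 (b) and §1.1.2 Prop. 1.1.9]
[cite: MoonenZarhin1998WeilClasses, §3 (3)] [cite: Zarhin2004EndomorphismRingsCyclicCovers, §2 (p0004)] -/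
theorem finrank_eigenspace_baseChange_pullbackFormsRat_inf_piece_one_zero_eq {B : Matrix ι ι ℚ} (hB : B ∈ endAlgRat Φ)
    (μ : ℂ) :
    finrank ℂ ↥(Module.End.eigenspace ((pullbackFormsRat Φ Φ B 1).baseChange ℂ) μ ⊓ (hodgeStructure Φ 1).piece 1 0) =
      finrank ℂ ↥(Module.End.eigenspace ((analyticRepHom Φ ⟨B, hB⟩ : E →L[ℂ] E) : E →ₗ[ℂ] E) μ) := by
  classical
  haveI : FiniteDimensional ℂ E := finiteDimensional_complex Φ
  set T : Module.End ℂ (ℂ ⊗[ℚ] rationalForms Φ 1) := (pullbackFormsRat Φ Φ B 1).baseChange ℂ with hTdef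
  set ρ : E →ₗ[ℂ] E := ((analyticRepHom Φ ⟨B, hB⟩ : E →L[ℂ] E) : E →ₗ[ℂ] E) with hρdef
  set S := Module.End.eigenspace T μ ⊓ (hodgeStructure Φ 1).piece 1 0 with hSdef
  -- the functional `ℓ x = Θ(x)(·)` and its two properties
  have hℓT : ∀ x v, oneForm.symm (complexification Φ 1 (T x)) v =
      oneForm.symm (complexification Φ 1 x) (ρ v) := fun x v ↦ by
    rw [hTdef, oneForm_symm_complexification_baseChange_pullbackFormsRat Φ hB, hρdef, ContinuousLinearMap.coe_coe]
  have hℓS : ∀ x ∈ S, ∀ v, oneForm.symm (complexification Φ 1 x) (ρ v) = μ * oneForm.symm (complexification Φ 1 x) v :=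
    fun x hx v ↦ by
    rw [← hℓT, Module.End.mem_eigenspace_iff.1 (Submodule.mem_inf.1 hx).1, map_smul, map_smul, smul_apply,
      smul_eq_mul]
  -- the `ℂ`-linear map `S → Hom_ℂ(E, ℂ)`
  let L : S →ₗ[ℂ] Module.Dual ℂ E :=
    { toFun := fun x ↦
        { toFun := fun v ↦ oneForm.symm (complexification Φ 1 x.1) v
          map_add' := fun v w ↦ map_add _ v w
          map_smul' := fun c v ↦ by
            rw [RingHom.id_apply, smul_eq_mul]
            exact (mem_piece_one_zero_iff_forall_smul Φ x.1).1 (Submodule.mem_inf.1 x.2).2 c v }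
      map_add' := fun x y ↦ by
        ext v
        simp only [Submodule.coe_add, map_add, add_apply, LinearMap.coe_mk, AddHom.coe_mk, LinearMap.add_apply]
      map_smul' := fun c x ↦ by
        ext v
        simp only [Submodule.coe_smul, map_smul, smul_apply, LinearMap.coe_mk, AddHom.coe_mk, LinearMap.smul_apply,
          RingHom.id_apply] }
  have hL : ∀ (x : S) (v : E), L x v = oneForm.symm (complexification Φ 1 x.1) v := fun x v ↦ rfl
  -- injective: a class is determined by its functional
  have hLinj : Function.Injective L := by
    intro x y hxy
    apply Subtype.ext
    apply (complexification Φ 1).injective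
    apply oneForm.symm.injective
    ext v
    rw [← hL, ← hL, hxy]
  -- its image is the `μ`-eigenspace of the transpose `ᵗρ`
  have hLrange : LinearMap.range L = Module.End.eigenspace ρ.dualMap μ := by
    apply le_antisymm
    · rintro _ ⟨x, rfl⟩
      rw [Module.End.mem_eigenspace_iff]
      ext v
      rw [LinearMap.dualMap_apply, LinearMap.smul_apply, hL, hL, smul_eq_mul]
      exact hℓS x.1 x.2 v
    · intro ℓ hℓ
      rw [Module.End.mem_eigenspace_iff] at hℓ
      -- the `(1,0)`-form of the continuous `ℂ`-linear functional `ℓ`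
      set ω : E [⋀^Fin 1]→L[ℝ] ℂ := oneForm ((LinearMap.toContinuousLinearMap ℓ).restrictScalars ℝ) with hωdef
      have hωapp : ∀ v : E, oneForm.symm ω v = ℓ v := fun v ↦ by
        rw [hωdef, LinearEquiv.symm_apply_apply, ContinuousLinearMap.coe_restrictScalars',
          LinearMap.coe_toContinuousLinearMap']
      set x : ℂ ⊗[ℚ] rationalForms Φ 1 := (complexification Φ 1).symm ω with hxdef
      have hxω : complexification Φ 1 x = ω := (complexification Φ 1).apply_symm_apply ω
      have hx10 : x ∈ (hodgeStructure Φ 1).piece 1 0 := by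
        rw [mem_piece_one_zero_iff_forall_smul, hxω]
        intro c v
        rw [hωapp, hωapp, map_smul, smul_eq_mul]
      have hxT : T x = μ • x := by
        apply (complexification Φ 1).injective
        apply oneForm.symm.injective
        ext v
        rw [hℓT, map_smul, map_smul, smul_apply, hxω, smul_eq_mul, hωapp, hωapp]
        have h := congrArg (fun φ : Module.Dual ℂ E ↦ φ v) hℓ
        simp only [LinearMap.dualMap_apply, LinearMap.smul_apply, smul_eq_mul] at h
        rw [hρdef, ContinuousLinearMap.coe_coe] at h
        exact h
      have hxS : x ∈ S := Submodule.mem_inf.2 ⟨Module.End.mem_eigenspace_iff.2 hxT, hx10⟩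
      refine ⟨⟨x, hxS⟩, ?_⟩
      ext v
      rw [hL, hxω, hωapp]
  rw [← finrank_eigenspace_dualMap_eq ρ μ, ← hLrange, LinearMap.finrank_range_of_inj hLinj]

/-- **THE `(0,1)` MULTIPLICITY OF `B^*` IS THE CONJUGATE TANGENT MULTIPLICITY: `dim_ℂ (ker((B^*)_ℂ − μ) ∩ H^{0,1}(X)) =
dim_ℂ ker(ρ_a(B) − μ̄)`** — complex conjugation of `H¹(X, ℂ) = ℂ ⊗ H¹(X, ℚ)` exchanges `H^{0,1}` with `H^{1,0}` and, `B^*` being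
rational, `ker((B^*)_ℂ − μ)` with `ker((B^*)_ℂ − μ̄)` («`H^{0,1}(X) ≅ Ω̄ = Hom_{ℂ̄}(V, ℂ)`»; «`ρ_r ⊗ 1 ≅ ρ_a ⊕ ρ̄_a`»).
[cite: Lange2023AbelianVarietiesComplex, §1.1.5 Thm. 1.1.21 (b) and §1.1.2 Prop. 1.1.9] [cite: MoonenZarhin1998WeilClasses, §3 (3) (`n_σ + n_σ̄`)] -/
theorem finrank_eigenspace_baseChange_pullbackFormsRat_inf_piece_zero_one_eq {B : Matrix ι ι ℚ} (hB : B ∈ endAlgRat Φ)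
    (μ : ℂ) :
    finrank ℂ ↥(Module.End.eigenspace ((pullbackFormsRat Φ Φ B 1).baseChange ℂ) μ ⊓ (hodgeStructure Φ 1).piece 0 1) =
      finrank ℂ ↥(Module.End.eigenspace ((analyticRepHom Φ ⟨B, hB⟩ : E →L[ℂ] E) : E →ₗ[ℂ] E) (conj μ)) := by
  rw [← finrank_complexConj (V := ↥(rationalForms Φ 1)), complexConj_inf, complexConj_eigenspace_baseChange,
    complexConj_piece]
  exact finrank_eigenspace_baseChange_pullbackFormsRat_inf_piece_one_zero_eq Φ hB (conj μ)

end One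

/-! ## §2 A number field `f : K → End_ℚ(X)` with a generator `θ`: the multiplicities `n_σ`, `n_σ̄` read on `H¹(X, ℚ)` -/

section Field

variable {ι : Type*} [Fintype ι] [DecidableEq ι] {E : Type*} [NormedAddCommGroup E] [NormedSpace ℂ E]
  (Φ : (ι → ℝ) ≃L[ℝ] E) {K : Type*} [Field K] [NumberField K] (f : K →ₐ[ℚ] Matrix ι ι ℚ) (hf : ∀ x, f x ∈ endAlgRat Φ)

open scoped IntermediateField in
/-- **`n_σ = dim_ℂ (ker((f(θ)^*)_ℂ − σθ) ∩ H^{1,0}(X))`** for a generator `θ` of `K = ℚ(θ)`: the multiplicity of `σ : K → ℂ` on the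
tangent space, `n_σ = dim_ℂ {v ∈ T₀X | ρ_a(f y) v = σ(y) v ∀ y ∈ K}` (`= dim ker(ρ_a(f θ) − σθ)`, the tree's
`iInf_eigenspace_analyticRepHom_eq_eigenspace`), is the dimension of the `σθ`-eigenspace of `(f(θ)^*)_ℂ` in `H^{1,0}(X)` («The dimension
`n_σ` of `V^{1,0}_{ℂ,σ}` is called the multiplicity of `σ`»). [cite: MoonenZarhin1998WeilClasses, §3 (3)] [cite: Zarhin2004EndomorphismRingsCyclicCovers, §2 (p0004)]
[cite: Lange2023AbelianVarietiesComplex, §1.1.5 Thm. 1.1.21 (b)] -/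
theorem finrank_eigenspace_baseChange_pullbackFormsRat_inf_piece_one_zero_eq_finrank_iInf_eigenspace {θ : K} (hθ : ℚ⟮θ⟯ = ⊤)
    (σ : K →+* ℂ) :
    finrank ℂ ↥(Module.End.eigenspace ((pullbackFormsRat Φ Φ (f θ) 1).baseChange ℂ) (σ θ) ⊓ (hodgeStructure Φ 1).piece 1 0) =
      finrank ℂ ↥(⨅ y : K, Module.End.eigenspace ((analyticRepHom Φ ⟨f y, hf y⟩ : E →L[ℂ] E) : E →ₗ[ℂ] E) (σ y)) := by
  rw [iInf_eigenspace_analyticRepHom_eq_eigenspace Φ f hf hθ σ]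
  exact finrank_eigenspace_baseChange_pullbackFormsRat_inf_piece_one_zero_eq Φ (hf θ) (σ θ)

open scoped IntermediateField in
/-- **`n_σ̄ = dim_ℂ (ker((f(θ)^*)_ℂ − σθ) ∩ H^{0,1}(X))`**: the same eigenspace of `(f(θ)^*)_ℂ` meets `H^{0,1}(X)` in the tangent
multiplicity of the CONJUGATE embedding `σ̄` («`n_σ + n_σ̄ = dim_k V`»; «`ρ_r ⊗ 1 ≅ ρ_a ⊕ ρ̄_a`»).
[cite: MoonenZarhin1998WeilClasses, §3 (3)] [cite: Lange2023AbelianVarietiesComplex, §1.1.2 Prop. 1.1.9 and §1.1.5 Thm. 1.1.21 (b)] -/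
theorem finrank_eigenspace_baseChange_pullbackFormsRat_inf_piece_zero_one_eq_finrank_iInf_eigenspace_conjugate {θ : K}
    (hθ : ℚ⟮θ⟯ = ⊤) (σ : K →+* ℂ) :
    finrank ℂ ↥(Module.End.eigenspace ((pullbackFormsRat Φ Φ (f θ) 1).baseChange ℂ) (σ θ) ⊓ (hodgeStructure Φ 1).piece 0 1) =
      finrank ℂ ↥(⨅ y : K, Module.End.eigenspace ((analyticRepHom Φ ⟨f y, hf y⟩ : E →L[ℂ] E) : E →ₗ[ℂ] E)
        (NumberField.ComplexEmbedding.conjugate σ y)) := by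
  rw [iInf_eigenspace_analyticRepHom_eq_eigenspace Φ f hf hθ (NumberField.ComplexEmbedding.conjugate σ),
    NumberField.ComplexEmbedding.conjugate_coe_eq]
  exact finrank_eigenspace_baseChange_pullbackFormsRat_inf_piece_zero_one_eq Φ (hf θ) (σ θ)

end Field

end ComplexTorus

end Literature.Geometry.Kaehler

end
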